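import Mathlib
import HarnessLib

/-!
# Convex-phase calculus for the transverse Brascamp–Lieb bound: the cosine tangent inequality on
# `[-1, 1]`, the derivative of `v ↦ ∑ u_p sin(v_p − c_p)` and its operator norm on a transverse subspace

Route-independent helper for the crux stmt-QuantumFields-23103 `Theses.TransverseWardBL.ConvexPhaseCoexactBound`
(route `TransverseWardBL`, LINE g9-C of the ideator seat ym-idea-4; abelian `U(1)` line onto the leaf
`Theorems.U1HelicityGapTorusD4` — nothing here bears on the Yang–Mills mass gap).

* `cos_le_tangent_sub_sq` — uniform concavity of `cos` on `[-1,1]`: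
  `cos b ≤ cos a − sin a (b − a) − (cos 1 / 2)(b − a)²` for `a, b ∈ [-1,1]`;
* `neg_sum_cos_firstOrder_convex` — the first-order `(β cos 1)`-convexity of
  `v ↦ −β ∑_p cos(v_p − c_p)` on the box `{|v_p − c_p| ≤ 1}` of `ℝ^P`;
* `hasFDerivAt_sum_mul_sin` — `D(∑ u_p sin(v_p − c_p)) = ∑_p u_p cos(v_p − c_p) • pr_p`;
* `abs_sum_mul_cos_mul_le` — for `u ⊥ h` (`∑ u_p h_p = 0`) and `|θ_p| ≤ 1`:
  `|∑ u_p cos θ_p h_p| ≤ (1 − cos 1) ‖u‖ ‖h‖` (the transverse gradient only sees `cos θ − 1`).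
-/

noncomputable section

open Set Filter Finset
open scoped Topology BigOperators

namespace Summit.QuantumFields.YangMills.Theorems.TransverseWardBL

/-! ### The cosine tangent inequality on `[-1, 1]` -/

/-- `cos 1 ≤ cos x` for `|x| ≤ 1`. [folklore] -/
theorem cos_one_le_cos_of_abs_le {x : ℝ} (hx : |x| ≤ 1) : Real.cos 1 ≤ Real.cos x := by
  rw [← Real.cos_abs x]
  exact Real.cos_le_cos_of_nonneg_of_le_pi (abs_nonneg x)
    (by linarith [Real.pi_gt_three]) hx

/-- **Uniform concavity of `cos` on `[-1,1]`** (tangent inequality with modulus `cos 1`):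
`cos b ≤ cos a − sin a (b − a) − (cos 1 / 2) (b − a)²` for `a, b ∈ [-1, 1]`. [folklore] -/
theorem cos_le_tangent_sub_sq {a b : ℝ} (ha : |a| ≤ 1) (hb : |b| ≤ 1) :
    Real.cos b ≤ Real.cos a - Real.sin a * (b - a) - Real.cos 1 / 2 * (b - a) ^ 2 := by
  set d : ℝ := b - a with hd
  -- `φ(t) = cos(a + t d) + sin a · t d + (cos 1 / 2) t² d² − cos a`, `φ(0) = 0`, `φ'(0) = 0`, `φ'' ≤ 0` on `[0,1]`
  set φ : ℝ → ℝ := fun t => Real.cos (a + t * d) + Real.sin a * (t * d) +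
    Real.cos 1 / 2 * (t * d) ^ 2 - Real.cos a with hφ
  set φ₁ : ℝ → ℝ := fun t => -Real.sin (a + t * d) * d + Real.sin a * d +
    Real.cos 1 * d ^ 2 * t with hφ₁
  set φ₂ : ℝ → ℝ := fun t => -Real.cos (a + t * d) * d * d + Real.cos 1 * d ^ 2 with hφ₂
  have hφd : ∀ t, HasDerivAt φ (φ₁ t) t := by
    intro t
    have h1 : HasDerivAt (fun t : ℝ => a + t * d) d t := by
      simpa using ((hasDerivAt_id' t).mul_const d).const_add a
    have h2 := h1.cos
    have h3 := ((hasDerivAt_id' t).mul_const d).const_mul (Real.sin a)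
    have h4 := (((hasDerivAt_id' t).mul_const d).pow 2).const_mul (Real.cos 1 / 2)
    have h := ((h2.add h3).add h4).sub_const (Real.cos a)
    refine h.congr_deriv ?_
    simp only [hφ₁, Nat.cast_ofNat]
    ring
  have hφ₁d : ∀ t, HasDerivAt φ₁ (φ₂ t) t := by
    intro t
    have h1 : HasDerivAt (fun t : ℝ => a + t * d) d t := by
      simpa using ((hasDerivAt_id' t).mul_const d).const_add a
    have h2 := h1.sin.const_mul (-d)
    have h3 := ((hasDerivAt_id' t).const_mul (Real.cos 1 * d ^ 2)).const_add (Real.sin a * d)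
    have h := h2.add h3
    have hF : φ₁ = fun y => -d * Real.sin (a + y * d) + (Real.sin a * d + Real.cos 1 * d ^ 2 * y) := by
      funext y; simp only [hφ₁]; ring
    rw [hF]
    refine h.congr_deriv ?_
    simp only [hφ₂]
    ring
  -- on `[0,1]` the point `a + t d` lies in `[-1,1]`, so `φ'' ≤ 0`
  have hmem : ∀ t ∈ Icc (0 : ℝ) 1, |a + t * d| ≤ 1 := by
    intro t ht
    have : a + t * d = (1 - t) * a + t * b := by rw [hd]; ring
    rw [this]
    calc |(1 - t) * a + t * b| ≤ |(1 - t) * a| + |t * b| := abs_add_le _ _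
      _ = (1 - t) * |a| + t * |b| := by
          rw [abs_mul, abs_mul, abs_of_nonneg (by linarith [ht.2]), abs_of_nonneg ht.1]
      _ ≤ (1 - t) * 1 + t * 1 := add_le_add (mul_le_mul_of_nonneg_left ha (by linarith [ht.2]))
          (mul_le_mul_of_nonneg_left hb ht.1)
      _ = 1 := by ring
  have hφ₂np : ∀ t ∈ Icc (0 : ℝ) 1, φ₂ t ≤ 0 := by
    intro t ht
    have hc := cos_one_le_cos_of_abs_le (hmem t ht)
    simp only [hφ₂]
    nlinarith [sq_nonneg d]
  -- `φ₁` is antitone on `[0,1]`, hence `≤ φ₁ 0 = 0`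
  have hφ₁anti : AntitoneOn φ₁ (Icc (0 : ℝ) 1) :=
    antitoneOn_of_deriv_nonpos (convex_Icc 0 1) (fun t _ => (hφ₁d t).continuousAt.continuousWithinAt)
      (fun t _ => (hφ₁d t).differentiableAt.differentiableWithinAt)
      (fun t ht => by
        rw [interior_Icc] at ht
        rw [(hφ₁d t).deriv]
        exact hφ₂np t ⟨ht.1.le, ht.2.le⟩)
  have hφ₁0 : φ₁ 0 = 0 := by simp [hφ₁]
  have hφ₁np : ∀ t ∈ Icc (0 : ℝ) 1, φ₁ t ≤ 0 := by
    intro t ht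
    have := hφ₁anti (left_mem_Icc.2 zero_le_one) ht ht.1
    rwa [hφ₁0] at this
  have hφanti : AntitoneOn φ (Icc (0 : ℝ) 1) :=
    antitoneOn_of_deriv_nonpos (convex_Icc 0 1) (fun t _ => (hφd t).continuousAt.continuousWithinAt)
      (fun t _ => (hφd t).differentiableAt.differentiableWithinAt)
      (fun t ht => by
        rw [interior_Icc] at ht
        rw [(hφd t).deriv]
        exact hφ₁np t ⟨ht.1.le, ht.2.le⟩)
  have hφ0 : φ 0 = 0 := by simp [hφ]
  have h10 := hφanti (left_mem_Icc.2 zero_le_one) (right_mem_Icc.2 zero_le_one) zero_le_one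
  rw [hφ0] at h10
  simp only [hφ, one_mul] at h10
  have : a + d = b := by rw [hd]; ring
  rw [this] at h10
  linarith

/-! ### First-order uniform convexity of `−β ∑ cos(v_p − c_p)` on the box -/

variable {P : Type*} [Fintype P]

/-- **First-order `(β cos 1)`-convexity of the convex-phase action**: for `β ≥ 0` and two points of the box
`{|v_p − c_p| ≤ 1}`,
`−β∑cos(v'_p − c_p) ≥ −β∑cos(v_p − c_p) + β∑ sin(v_p − c_p)(v'_p − v_p) + (β cos 1/2)∑(v'_p − v_p)²`. [folklore] -/
theorem neg_sum_cos_firstOrder_convex {β : ℝ} (hβ : 0 ≤ β) (c v v' : P → ℝ)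
    (hv : ∀ p, |v p - c p| ≤ 1) (hv' : ∀ p, |v' p - c p| ≤ 1) :
    -(β * ∑ p, Real.cos (v p - c p)) + β * ∑ p, Real.sin (v p - c p) * (v' p - v p) +
        β * Real.cos 1 / 2 * ∑ p, (v' p - v p) ^ 2 ≤ -(β * ∑ p, Real.cos (v' p - c p)) := by
  have key : ∀ p, Real.cos (v' p - c p) ≤ Real.cos (v p - c p) - Real.sin (v p - c p) * (v' p - v p) -
      Real.cos 1 / 2 * (v' p - v p) ^ 2 := fun p => by
    have h := cos_le_tangent_sub_sq (hv p) (hv' p)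
    have e : v' p - c p - (v p - c p) = v' p - v p := by ring
    rwa [e] at h
  have hsum := Finset.sum_le_sum fun p (_ : p ∈ Finset.univ) => key p
  rw [Finset.sum_sub_distrib, Finset.sum_sub_distrib, ← Finset.mul_sum] at hsum
  nlinarith [hsum, Finset.sum_nonneg fun p (_ : p ∈ Finset.univ) => sq_nonneg (v' p - v p)]

/-! ### The test functional `∑ u_p sin(v_p − c_p)` on `ℝ^P` -/

/-- The derivative of `v ↦ ∑_p u_p sin(v_p − c_p)` on `ℝ^P = EuclideanSpace ℝ P`. [folklore] -/
theorem hasFDerivAt_sum_mul_sin (u c : P → ℝ) (v : EuclideanSpace ℝ P) :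
    HasFDerivAt (fun v : EuclideanSpace ℝ P => ∑ p, u p * Real.sin (v p - c p))
      (∑ p, (u p * Real.cos (v p - c p)) • (EuclideanSpace.proj p : EuclideanSpace ℝ P →L[ℝ] ℝ)) v := by
  refine HasFDerivAt.fun_sum fun p _ => ?_
  have h1 : HasFDerivAt (fun v : EuclideanSpace ℝ P => v p - c p)
      (EuclideanSpace.proj p : EuclideanSpace ℝ P →L[ℝ] ℝ) v :=
    ((EuclideanSpace.proj p : EuclideanSpace ℝ P →L[ℝ] ℝ).hasFDerivAt).sub_const (c p)
  have h2 := (h1.sin).const_mul (u p)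
  refine h2.congr_fderiv ?_
  rw [smul_smul]

/-- Cauchy–Schwarz on `ℝ^P` for plain functions. [folklore] -/
theorem abs_sum_mul_le_sqrt_mul_sqrt (a h : P → ℝ) :
    |∑ p, a p * h p| ≤ Real.sqrt (∑ p, a p ^ 2) * Real.sqrt (∑ p, h p ^ 2) := by
  have h1 := Real.sum_mul_le_sqrt_mul_sqrt Finset.univ a h
  have h2 := Real.sum_mul_le_sqrt_mul_sqrt Finset.univ (fun p => -a p) h
  simp only [neg_mul, Finset.sum_neg_distrib, even_two, Even.neg_pow] at h2
  exact abs_le.2 ⟨by linarith, h1⟩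

/-- **The transverse gradient bound**: if `∑ u_p h_p = 0` and `|θ_p| ≤ 1` for all `p`, then
`|∑ u_p cos θ_p h_p| ≤ (1 − cos 1) ‖u‖₂ ‖h‖₂` — only `cos θ − 1 ∈ [cos 1 − 1, 0]` is seen. [folklore] -/
theorem abs_sum_mul_cos_mul_le (u h θ : P → ℝ) (hu : ∑ p, u p * h p = 0) (hθ : ∀ p, |θ p| ≤ 1) :
    |∑ p, u p * Real.cos (θ p) * h p| ≤
      (1 - Real.cos 1) * Real.sqrt (∑ p, u p ^ 2) * Real.sqrt (∑ p, h p ^ 2) := by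
  have e : ∑ p, u p * Real.cos (θ p) * h p = ∑ p, (u p * (Real.cos (θ p) - 1)) * h p := by
    rw [← sub_zero (∑ p, u p * Real.cos (θ p) * h p), ← hu, ← Finset.sum_sub_distrib]
    exact Finset.sum_congr rfl fun p _ => by ring
  rw [e]
  refine (abs_sum_mul_le_sqrt_mul_sqrt _ _).trans ?_
  refine mul_le_mul_of_nonneg_right ?_ (Real.sqrt_nonneg _)
  have hc1 : Real.cos 1 ≤ 1 := Real.cos_le_one 1
  have hterm : ∀ p, (u p * (Real.cos (θ p) - 1)) ^ 2 ≤ (1 - Real.cos 1) ^ 2 * u p ^ 2 := fun p => by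
    have h1 := cos_one_le_cos_of_abs_le (hθ p)
    have h2 := Real.cos_le_one (θ p)
    have h3 : (Real.cos (θ p) - 1) ^ 2 ≤ (1 - Real.cos 1) ^ 2 := by
      rw [show (Real.cos (θ p) - 1) ^ 2 = (1 - Real.cos (θ p)) ^ 2 by ring]
      exact pow_le_pow_left₀ (sub_nonneg.2 h2) (by linarith) 2
    rw [mul_pow, mul_comm]
    exact mul_le_mul_of_nonneg_right h3 (sq_nonneg _)
  calc Real.sqrt (∑ p, (u p * (Real.cos (θ p) - 1)) ^ 2)
      ≤ Real.sqrt ((1 - Real.cos 1) ^ 2 * ∑ p, u p ^ 2) := by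
        refine Real.sqrt_le_sqrt ?_
        rw [Finset.mul_sum]
        exact Finset.sum_le_sum fun p _ => hterm p
    _ = (1 - Real.cos 1) * Real.sqrt (∑ p, u p ^ 2) := by
        rw [Real.sqrt_mul' _ (Finset.sum_nonneg fun p _ => sq_nonneg (u p)),
          Real.sqrt_sq (sub_nonneg.2 hc1)]

/-- Numerical constant: `(1 − cos 1)² ≤ (9/20) cos 1` (indeed `(1 − cos 1)²/cos 1 = 0.391…`). [folklore] -/
theorem one_sub_cos_one_sq_le : (1 - Real.cos 1) ^ 2 ≤ 9 / 20 * Real.cos 1 := by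
  -- `cos 1 = 1 − 2 sin²(1/2)` and `sin(1/2) ≤ 1/2 − 1/48 + 5/1536`
  have hs := Real.sin_bound (show |(1 / 2 : ℝ)| ≤ 1 by norm_num)
  have hs' : Real.sin (1 / 2) ≤ 0.4825 := by
    have := (abs_le.1 hs).2
    norm_num at this ⊢
    linarith
  have hs0 : 0 ≤ Real.sin (1 / 2) := Real.sin_nonneg_of_nonneg_of_le_pi (by norm_num)
    (by linarith [Real.pi_gt_three])
  have hc : Real.cos 1 = 1 - 2 * Real.sin (1 / 2) ^ 2 := by
    have h2 : Real.cos 1 = 2 * Real.cos (1 / 2) ^ 2 - 1 := by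
      rw [← Real.cos_two_mul]; norm_num
    have h3 : Real.sin (1 / 2) ^ 2 + Real.cos (1 / 2) ^ 2 = 1 := Real.sin_sq_add_cos_sq _
    linarith
  have hcl : 0.534 ≤ Real.cos 1 := by
    rw [hc]; nlinarith
  have hcu : Real.cos 1 ≤ 1 := Real.cos_le_one 1
  nlinarith

end Summit.QuantumFields.YangMills.Theorems.TransverseWardBL

end
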